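/-
Copyright (c) 2026 the pub-hodgecm-mathlib formalisation cell (harness21).  Prover seat hodgecm-mathlib-K2E5-p16 (g5): Track B «K2-LIT»,
hLiu418 = stmt-HodgeConjecture-24832, ROAD Φ organ (SD-2) (arch integrals of twisted Gaussians = `ξ` in the `g`-binder), file (7a): the
β-shifted `η` for a COMPLEX parameter matrix `G` dominated by a positive definite one; 2026-09-04.
-/
import Summits.HodgeConjecture.HodgeConjecture.Theorems.K2LiuHermTwoEtaShiftConvergence      -- ★ p858395: convergence, weight bound
import Summits.HodgeConjecture.HodgeConjecture.Theorems.K2LiuHermTwoEtaShiftHolomorphy      -- ★ p858462: the Hermitian case (4), integrand derivative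
import HarnessLib

/-!
# Crux `HLiu418`, ROAD Φ, organ (SD-2) — file (7a): `etaShift G h α β` for a complex `G` DOMINATED by a positive definite `g₁`

Cell `hodgecm-mathlib`, crux item hLiu418 = `stmt-HodgeConjecture-24832`, route of record `HCCMUnconditional`; squad K2, LEAD F0P6-plan (g13)
(M-157i′, deal (SD-2) 2026-09-04 09:08:36Z), co-dealer K2E5-plan (g6) («= RE-BASE ON THE g-BINDER» 09:11:18Z), prover K2E5-p16 (g5).
THEOREMS ONLY; lane `--supports stmt-HodgeConjecture-24832 --as helper`.

WHY.  The archimedean Whittaker integral of the TWISTED Gaussian `e^{−π tr(T⟨x,x⟩)}` is `c·ξ(T∕2, h; α, β)`: the `K_∞`-type parameter sits in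
the `g`-binder of `ξ`, and (SD-2) differentiates `t ↦ xiShift (g₀ + t•Ξ) h α β` in a COMPLEX `t` (one-variable Cauchy).  For complex `t` the
matrix `G = 2(g₀ + tΞ)` is no longer Hermitian; all that survives — and all that is needed — is DOMINATION on the domain:
`‖e^{−tr(xG)}‖ ≤ ‖e^{−tr(x g₁)}‖` for a positive definite `g₁` (true when the Hermitian part of `G` is `≥ g₁`).
WHAT.  For `g₁, h > 0`, `G` any complex `2 × 2` matrix with `hdom : ∀ x ∈ {x ± h > 0}, ‖cexp(−tr(xG))‖ ≤ ‖cexp(−tr(x g₁))‖`: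
* `integrableOn_etaShiftIntegrand_of_dominated … (hβ : 0 < re β)` — the β-shifted integrand of `G` converges absolutely;
* `hasDerivAt_etaShift_affine_of_dominated`, `differentiableOn_etaShift_affine_of_dominated` — `s ↦ etaShift G h (α₀ + us) (β₀ + vs)` is
  holomorphic on `{s | 0 < re(β₀ + vs)}` (★ (4)'s proof verbatim with every majorant taken at `g₁` and the weight through `‖G₀₀‖`).
HONEST LABEL.  Count-neutral helper of the K2_Liu road; it pays no socket by itself: `HC_CM` is proved only modulo the 7 printed citations
(2 remaining named inputs: hLiu418 = `stmt-HodgeConjecture-24832`, h413 = `stmt-HodgeConjecture-24833`) until rung 0 closes.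
-/

set_option autoImplicit false
-- the mandated namespace repeats the single-problem summit's segment (`HodgeConjecture.HodgeConjecture`)
set_option linter.dupNamespace false

noncomputable section

open Complex MeasureTheory Set
open scoped ComplexOrder ComplexConjugate

namespace Summit.HodgeConjecture.HodgeConjecture.Cruxes.HLiu418.K2LiuHermTwoEtaShiftDominated

open Summit.HodgeConjecture.HodgeConjecture.Cruxes.HLiu418.K2LiuHermTwoGammaDefs
open Summit.HodgeConjecture.HodgeConjecture.Cruxes.HLiu418.K2LiuHermTwoEtaDefs
open Summit.HodgeConjecture.HodgeConjecture.Cruxes.HLiu418.K2LiuHermTwoEtaConvergence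
open Summit.HodgeConjecture.HodgeConjecture.Cruxes.HLiu418.K2LiuHermTwoEtaHolomorphy
open Summit.HodgeConjecture.HodgeConjecture.Cruxes.HLiu418.K2LiuHermTwoEtaLineHolomorphy
open Summit.HodgeConjecture.HodgeConjecture.Cruxes.HLiu418.K2LiuHermTwoEtaShiftDefs
open Summit.HodgeConjecture.HodgeConjecture.Cruxes.HLiu418.K2LiuHermTwoEtaShiftConvergence
open Summit.HodgeConjecture.HodgeConjecture.Cruxes.HLiu418.K2LiuHermTwoEtaShiftHolomorphy

/-! ## Domination of the `η`-integrand -/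

/-- DOMINATION: if `‖e^{−tr(xG)}‖ ≤ ‖e^{−tr(x g₁)}‖` then the whole `η`-integrand of `G` is dominated by that of `g₁` (same exponents). -/
theorem norm_etaTwoIntegrand_le_of_dominated {G g₁ h : Matrix (Fin 2) (Fin 2) ℂ} {c : ℝ × ℂ × ℝ}
    (hdom : ‖cexp (-(hermTwo c * G).trace)‖ ≤ ‖cexp (-(hermTwo c * g₁).trace)‖) (α β : ℂ) :
    ‖etaTwoIntegrand G h α β c‖ ≤ ‖etaTwoIntegrand g₁ h α β c‖ := by
  rw [etaTwoIntegrand_apply, etaTwoIntegrand_apply]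
  simp only [norm_mul]
  exact mul_le_mul_of_nonneg_right hdom (by positivity)

/-- The `(1,1)` weight denominator is the same for `G` and `g₁`; the shifted integrand of `G` is dominated through the weight bound. -/
theorem norm_etaShiftIntegrand_le_of_dominated (G : Matrix (Fin 2) (Fin 2) ℂ) {g₁ : Matrix (Fin 2) (Fin 2) ℂ} {e c : ℝ × ℂ × ℝ}
    (he : (hermTwo e).PosDef) (hc : (hermTwo c - hermTwo e).PosDef)
    (hdom : ‖cexp (-(hermTwo c * G).trace)‖ ≤ ‖cexp (-(hermTwo c * g₁).trace)‖) (α β : ℂ) :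
    ‖etaShiftIntegrand G (hermTwo e) α β c‖ ≤
      (‖G 0 0‖ + 2 * e.2.2 * ‖α - 2‖ / ((e + e).1 * (e + e).2.2 - normSq (e + e).2.1)) *
          (‖((hermTwo c - hermTwo e) 1 1)⁻¹‖ * ‖etaTwoIntegrand g₁ (hermTwo e) α (β + 1) c‖) +
        ‖α - 2‖ / ((e + e).1 * (e + e).2.2 - normSq (e + e).2.1) * ‖etaTwoIntegrand g₁ (hermTwo e) α (β + 1) c‖ := by
  have hbt : 0 < c.2.2 - e.2.2 := sub_snd_pos_of_mem hc
  have hW := norm_etaShiftWeight_le G he hc α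
  have hE := norm_etaTwoIntegrand_le_of_dominated (h := hermTwo e) hdom α (β + 1)
  have hWn : ‖((hermTwo c - hermTwo e) 1 1)⁻¹‖ = (c.2.2 - e.2.2)⁻¹ := by
    rw [hermTwo_sub_apply_one_one, hermTwo_apply_one_one, ← Complex.ofReal_sub, norm_inv, Complex.norm_of_nonneg hbt.le]
  rw [etaShiftIntegrand_apply, norm_mul, hWn]
  have h2e := (posDef_hermTwo_iff (e + e)).mp (by rw [hermTwo_add]; exact he.add he)
  have hδ : 0 < (e + e).1 * (e + e).2.2 - normSq (e + e).2.1 := by linarith [h2e.2]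
  have he3 : 0 < e.2.2 := by
    have hee := (posDef_hermTwo_iff e).mp he
    exact snd_pos_of_cone hee.1 hee.2
  have hA0 : 0 ≤ ‖G 0 0‖ + 2 * e.2.2 * ‖α - 2‖ / ((e + e).1 * (e + e).2.2 - normSq (e + e).2.1) := by positivity
  have hB0 : 0 ≤ ‖α - 2‖ / ((e + e).1 * (e + e).2.2 - normSq (e + e).2.1) := by positivity
  calc ‖etaShiftWeight G (hermTwo e) α c‖ * ‖etaTwoIntegrand G (hermTwo e) α (β + 1) c‖
      ≤ ((‖G 0 0‖ + 2 * e.2.2 * ‖α - 2‖ / ((e + e).1 * (e + e).2.2 - normSq (e + e).2.1)) * (c.2.2 - e.2.2)⁻¹ +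
          ‖α - 2‖ / ((e + e).1 * (e + e).2.2 - normSq (e + e).2.1)) * ‖etaTwoIntegrand g₁ (hermTwo e) α (β + 1) c‖ :=
        mul_le_mul hW hE (norm_nonneg _) (add_nonneg (mul_nonneg hA0 (inv_nonneg.mpr hbt.le)) hB0)
    _ = _ := by ring

/-! ## Convergence of the β-shifted integrand for dominated `G` -/

/-- **ABSOLUTE CONVERGENCE FOR DOMINATED `G`**: for `g₁, h > 0`, a complex `G` dominated by `g₁` on the domain, every `α` and `re β > 0`,
the β-shifted integrand of `G` is integrable on `{x ± h > 0}`. -/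
theorem integrableOn_etaShiftIntegrand_of_dominated {G g₁ h : Matrix (Fin 2) (Fin 2) ℂ} (hg₁ : g₁.PosDef) (hh : h.PosDef)
    (hdom : ∀ c ∈ etaTwoSet h, ‖cexp (-(hermTwo c * G).trace)‖ ≤ ‖cexp (-(hermTwo c * g₁).trace)‖) (α : ℂ) {β : ℂ} (hβ : 0 < β.re) :
    IntegrableOn (etaShiftIntegrand G h α β) (etaTwoSet h) := by
  have hβ1 : 1 < (β + 1).re := by simp only [add_re, one_re]; linarith
  obtain ⟨e, rfl⟩ : ∃ e : ℝ × ℂ × ℝ, hermTwo e = h := ⟨_, hermTwo_eq_of_isHermitian hh.1⟩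
  have hI1 : IntegrableOn (fun c : ℝ × ℂ × ℝ => ‖((hermTwo c - hermTwo e) 1 1)⁻¹‖ * ‖etaTwoIntegrand g₁ (hermTwo e) α (β + 1) c‖)
      (etaTwoSet (hermTwo e)) := by
    have h := (integrableOn_inv_mul_etaTwoIntegrand_of_posDef hg₁ hh α hβ1).norm
    rw [IntegrableOn]
    simpa only [norm_mul] using h
  have hI2 := (integrableOn_etaTwoIntegrand_of_posDef hg₁ hh α hβ1).norm
  refine ((hI1.const_mul (‖G 0 0‖ + 2 * e.2.2 * ‖α - 2‖ / ((e + e).1 * (e + e).2.2 - normSq (e + e).2.1))).add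
    (hI2.const_mul (‖α - 2‖ / ((e + e).1 * (e + e).2.2 - normSq (e + e).2.1)))).mono'
    (aestronglyMeasurable_etaShiftIntegrand G (hermTwo e) α β _) ?_
  refine (ae_restrict_iff' (measurableSet_etaTwoSet hh.1)).mpr (Filter.Eventually.of_forall fun c hc => ?_)
  obtain ⟨-, hcm⟩ := (mem_etaTwoSet_iff (hermTwo e) c).mp hc
  exact norm_etaShiftIntegrand_le_of_dominated G hh hcm (hdom c hc) α β

/-! ## Holomorphy of the β-shifted `η` of a dominated `G` along complex lines -/

set_option maxHeartbeats 400000 in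
-- the (4) template; hub lake-build budget as in ★ `K2LiuHermTwoEtaShiftHolomorphy` (BW106-HB)
/-- **DIFFERENTIATION UNDER THE INTEGRAL SIGN FOR A DOMINATED `G`**: for `g₁, h > 0`, a complex `G` dominated by `g₁` on the domain,
`α₀ β₀ u v : ℂ` and `re(β₀ + v s₀) > 0`, `s ↦ etaShift(G, h; α₀ + us, β₀ + vs)` has a complex derivative at `s₀`. -/
theorem hasDerivAt_etaShift_affine_of_dominated {G g₁ h : Matrix (Fin 2) (Fin 2) ℂ} (hg₁ : g₁.PosDef) (hh : h.PosDef)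
    (hdom : ∀ c ∈ etaTwoSet h, ‖cexp (-(hermTwo c * G).trace)‖ ≤ ‖cexp (-(hermTwo c * g₁).trace)‖) (α₀ β₀ u v : ℂ) {s₀ : ℂ}
    (hs₀ : 0 < (β₀ + v * s₀).re) :
    HasDerivAt (fun s : ℂ => etaShift G h (α₀ + u * s) (β₀ + v * s))
      (∫ c in etaTwoSet h, (etaShiftIntegrand G h (α₀ + u * s₀) (β₀ + v * s₀) c *
          (u * Complex.log ((hermTwo c + h).det) + v * Complex.log ((hermTwo c - h).det)) +
        -(u * ((hermTwo c + h) 1 1 / (hermTwo c + h).det)) / (hermTwo c - h) 1 1 *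
          etaTwoIntegrand G h (α₀ + u * s₀) (β₀ + 1 + v * s₀) c)) s₀ := by
  have hfun : (fun s : ℂ => etaShift G h (α₀ + u * s) (β₀ + v * s)) =
      fun s => ∫ c in etaTwoSet h, etaShiftIntegrand G h (α₀ + u * s) (β₀ + v * s) c :=
    funext fun s => etaShift_def G h _ _
  rw [hfun]
  obtain ⟨e, rfl⟩ : ∃ e : ℝ × ℂ × ℝ, hermTwo e = h := ⟨_, hermTwo_eq_of_isHermitian hh.1⟩
  have hee := (posDef_hermTwo_iff e).mp hh
  have he3 : 0 < e.2.2 := snd_pos_of_cone hee.1 hee.2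
  have h2e := (posDef_hermTwo_iff (e + e)).mp (by rw [hermTwo_add]; exact hh.add hh)
  set δ : ℝ := (e + e).1 * (e + e).2.2 - normSq (e + e).2.1 with hδdef
  have hδ : 0 < δ := by rw [hδdef]; linarith [h2e.2]
  -- the radius and the exponent ranges (for the `η`-integrand at `β + 1`)
  set a₀ : ℝ := (α₀ + u * s₀).re with ha₀
  set b₀ : ℝ := (β₀ + 1 + v * s₀).re with hb₀
  have hb₀' : b₀ = (β₀ + v * s₀).re + 1 := by rw [hb₀]; simp only [add_re, one_re]; ring
  set ε : ℝ := (b₀ - 1) / (2 * (‖v‖ + 1)) with hε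
  have hb₀1 : 0 < b₀ - 1 := by rw [hb₀']; linarith
  have hεpos : 0 < ε := div_pos hb₀1 (by positivity)
  have hvε : ‖v‖ * ε ≤ (b₀ - 1) / 2 := by
    rw [hε, show ‖v‖ * ((b₀ - 1) / (2 * (‖v‖ + 1))) = (b₀ - 1) / 2 * (‖v‖ / (‖v‖ + 1)) by field_simp]
    have h2 : ‖v‖ / (‖v‖ + 1) ≤ 1 := (div_le_one (by positivity)).mpr (by linarith)
    nlinarith
  set a₁ : ℝ := a₀ - ‖u‖ * ε with ha₁; set a₂ : ℝ := a₀ + ‖u‖ * ε with ha₂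
  set b₁ : ℝ := b₀ - ‖v‖ * ε with hb₁; set b₂ : ℝ := b₀ + ‖v‖ * ε with hb₂
  have hb₁1 : 1 < b₁ := by rw [hb₁]; linarith
  have hb₂1 : 1 < b₂ := by rw [hb₂]; nlinarith [norm_nonneg v]
  set θ : ℝ := (b₁ - 1) / 2 with hθ
  have hθpos : 0 < θ := by rw [hθ]; linarith
  set K₁ : ℝ := max 1 (δ ^ (a₁ - a₂)) with hK₁
  set K₂ : ℝ := |Real.log δ| / δ + 1 with hK₂
  have hK₁0 : 0 ≤ K₁ := le_trans zero_le_one (le_max_left _ _)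
  have hK₂0 : 0 ≤ K₂ := by positivity
  -- the weight's constants: `‖α − 2‖ ≤ M` on the ball, `‖Q_α‖ ≤ A b̃⁻¹ + B`
  set M : ℝ := ‖α₀ + u * s₀ - 2‖ + ‖u‖ * ε with hM
  have hM0 : 0 ≤ M := by positivity
  set A : ℝ := ‖G 0 0‖ + 2 * e.2.2 * M / δ with hA
  set B : ℝ := M / δ with hB
  have hA0 : 0 ≤ A := by positivity
  have hB0 : 0 ≤ B := by positivity
  -- the sixteen integrable majorant pieces: eight `η`-norms and eight weighted `η`-norms (at real exponents `b > 1`)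
  have hN := fun (a b : ℝ) (hb : 1 < b) =>
    (integrableOn_etaTwoIntegrand_of_posDef hg₁ hh ((a : ℝ) : ℂ) (β := ((b : ℝ) : ℂ)) (by simpa using hb)).norm
  have hWN : ∀ (a b : ℝ), 1 < b → IntegrableOn (fun c : ℝ × ℂ × ℝ =>
      ‖((hermTwo c - hermTwo e) 1 1)⁻¹‖ * ‖etaTwoIntegrand g₁ (hermTwo e) ((a : ℝ) : ℂ) ((b : ℝ) : ℂ) c‖) (etaTwoSet (hermTwo e)) := by
    intro a b hb
    have h := (integrableOn_inv_mul_etaTwoIntegrand_of_posDef hg₁ hh ((a : ℝ) : ℂ) (β := ((b : ℝ) : ℂ)) (by simpa using hb)).norm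
    rw [IntegrableOn]
    simpa only [norm_mul] using h
  have hb₁θ : 1 < b₁ + θ := by linarith
  have hb₁θ' : 1 < b₁ - θ := by rw [hθ]; linarith
  have hb₂θ : 1 < b₂ + θ := by linarith
  have hb₂θ' : 1 < b₂ - θ := by rw [hθ]; nlinarith [norm_nonneg v]
  have hI1 := hN a₂ b₁ hb₁1; have hI2 := hN a₂ b₂ hb₂1; have hI3 := hN (a₂ + 1) b₁ hb₁1; have hI4 := hN (a₂ + 1) b₂ hb₂1
  have hI5 := hN a₂ (b₁ + θ) hb₁θ; have hI6 := hN a₂ (b₁ - θ) hb₁θ'; have hI7 := hN a₂ (b₂ + θ) hb₂θ; have hI8 := hN a₂ (b₂ - θ) hb₂θ'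
  have hJ1 := hWN a₂ b₁ hb₁1; have hJ2 := hWN a₂ b₂ hb₂1; have hJ3 := hWN (a₂ + 1) b₁ hb₁1; have hJ4 := hWN (a₂ + 1) b₂ hb₂1
  have hJ5 := hWN a₂ (b₁ + θ) hb₁θ; have hJ6 := hWN a₂ (b₁ - θ) hb₁θ'; have hJ7 := hWN a₂ (b₂ + θ) hb₂θ
  have hJ8 := hWN a₂ (b₂ - θ) hb₂θ'
  refine (hasDerivAt_integral_of_dominated_loc_of_deriv_le (μ := (volume : Measure (ℝ × ℂ × ℝ)).restrict (etaTwoSet (hermTwo e)))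
    (F := fun s c => etaShiftIntegrand G (hermTwo e) (α₀ + u * s) (β₀ + v * s) c)
    (F' := fun s c => etaShiftIntegrand G (hermTwo e) (α₀ + u * s) (β₀ + v * s) c *
        (u * Complex.log ((hermTwo c + hermTwo e).det) + v * Complex.log ((hermTwo c - hermTwo e).det)) +
      -(u * ((hermTwo c + hermTwo e) 1 1 / (hermTwo c + hermTwo e).det)) / (hermTwo c - hermTwo e) 1 1 *
        etaTwoIntegrand G (hermTwo e) (α₀ + u * s) (β₀ + 1 + v * s) c)
    (bound := fun c =>
      ‖u‖ * K₁ / δ * (‖etaTwoIntegrand g₁ (hermTwo e) ((a₂ : ℝ) : ℂ) ((b₁ : ℝ) : ℂ) c‖ + ‖etaTwoIntegrand g₁ (hermTwo e) ((a₂ : ℝ) : ℂ) ((b₂ : ℝ) : ℂ) c‖) +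
      ‖u‖ * K₁ * (2 * e.2.2 / δ) *
        (‖((hermTwo c - hermTwo e) 1 1)⁻¹‖ * ‖etaTwoIntegrand g₁ (hermTwo e) ((a₂ : ℝ) : ℂ) ((b₁ : ℝ) : ℂ) c‖ +
          ‖((hermTwo c - hermTwo e) 1 1)⁻¹‖ * ‖etaTwoIntegrand g₁ (hermTwo e) ((a₂ : ℝ) : ℂ) ((b₂ : ℝ) : ℂ) c‖) +
      B * (‖u‖ * (K₁ * K₂) *
          (‖etaTwoIntegrand g₁ (hermTwo e) ((a₂ + 1 : ℝ) : ℂ) ((b₁ : ℝ) : ℂ) c‖ + ‖etaTwoIntegrand g₁ (hermTwo e) ((a₂ + 1 : ℝ) : ℂ) ((b₂ : ℝ) : ℂ) c‖) +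
        ‖v‖ / θ * K₁ *
          (‖etaTwoIntegrand g₁ (hermTwo e) ((a₂ : ℝ) : ℂ) ((b₁ + θ : ℝ) : ℂ) c‖ + ‖etaTwoIntegrand g₁ (hermTwo e) ((a₂ : ℝ) : ℂ) ((b₁ - θ : ℝ) : ℂ) c‖ +
            ‖etaTwoIntegrand g₁ (hermTwo e) ((a₂ : ℝ) : ℂ) ((b₂ + θ : ℝ) : ℂ) c‖ + ‖etaTwoIntegrand g₁ (hermTwo e) ((a₂ : ℝ) : ℂ) ((b₂ - θ : ℝ) : ℂ) c‖)) +
      A * (‖u‖ * (K₁ * K₂) *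
          (‖((hermTwo c - hermTwo e) 1 1)⁻¹‖ * ‖etaTwoIntegrand g₁ (hermTwo e) ((a₂ + 1 : ℝ) : ℂ) ((b₁ : ℝ) : ℂ) c‖ +
            ‖((hermTwo c - hermTwo e) 1 1)⁻¹‖ * ‖etaTwoIntegrand g₁ (hermTwo e) ((a₂ + 1 : ℝ) : ℂ) ((b₂ : ℝ) : ℂ) c‖) +
        ‖v‖ / θ * K₁ *
          (‖((hermTwo c - hermTwo e) 1 1)⁻¹‖ * ‖etaTwoIntegrand g₁ (hermTwo e) ((a₂ : ℝ) : ℂ) ((b₁ + θ : ℝ) : ℂ) c‖ +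
            ‖((hermTwo c - hermTwo e) 1 1)⁻¹‖ * ‖etaTwoIntegrand g₁ (hermTwo e) ((a₂ : ℝ) : ℂ) ((b₁ - θ : ℝ) : ℂ) c‖ +
            ‖((hermTwo c - hermTwo e) 1 1)⁻¹‖ * ‖etaTwoIntegrand g₁ (hermTwo e) ((a₂ : ℝ) : ℂ) ((b₂ + θ : ℝ) : ℂ) c‖ +
            ‖((hermTwo c - hermTwo e) 1 1)⁻¹‖ * ‖etaTwoIntegrand g₁ (hermTwo e) ((a₂ : ℝ) : ℂ) ((b₂ - θ : ℝ) : ℂ) c‖)))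
    (Metric.ball_mem_nhds s₀ hεpos) ?_ ?_ ?_ ?_ ?_ ?_).2
  · -- measurability of `F s`
    exact Filter.Eventually.of_forall fun s => aestronglyMeasurable_etaShiftIntegrand G (hermTwo e) _ _ _
  · -- integrability at `s₀`
    exact integrableOn_etaShiftIntegrand_of_dominated hg₁ hh hdom _ hs₀
  · -- measurability of `F' s₀`
    refine (((measurable_etaShiftIntegrand G (hermTwo e) _ _).mul
      ((measurable_const.mul (Complex.measurable_log.comp (continuous_det_hermTwo_add (hermTwo e)).measurable)).add
        (measurable_const.mul (Complex.measurable_log.comp (continuous_det_hermTwo_sub (hermTwo e)).measurable)))).add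
      (Measurable.mul ?_ (measurable_etaTwoIntegrand G (hermTwo e) _ _))).aestronglyMeasurable
    have h11 : Measurable fun c : ℝ × ℂ × ℝ => (hermTwo c + hermTwo e) 1 1 := by
      simp_rw [hermTwo_add_apply_one_one]
      fun_prop
    have h11' : Measurable fun c : ℝ × ℂ × ℝ => (hermTwo c - hermTwo e) 1 1 := by
      simp_rw [hermTwo_sub_apply_one_one]
      fun_prop
    exact (measurable_const.mul (h11.div (continuous_det_hermTwo_add (hermTwo e)).measurable)).neg.div h11'
  · -- THE DOMINATION on the ball, for `x` in the domain
    refine (ae_restrict_iff' (measurableSet_etaTwoSet hh.1)).mpr (Filter.Eventually.of_forall fun c hc s hs => ?_)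
    have hsd : ‖s - s₀‖ < ε := by rw [← dist_eq_norm]; exact hs
    obtain ⟨hcp, hcm⟩ := (mem_etaTwoSet_iff (hermTwo e) c).mp hc
    have hue := (posDef_hermTwo_iff (c - e)).mp (by rwa [hermTwo_sub])
    -- the two positive determinants and the positive entry `b̃ = (x − h)₁₁`
    set p : ℝ := (c + e).1 * (c + e).2.2 - normSq (c + e).2.1 with hpdef
    set q : ℝ := (c - e).1 * (c - e).2.2 - normSq (c - e).2.1 with hqdef
    have hδp : δ ≤ p := det_two_le_det_add hh hcm
    have hp : 0 < p := lt_of_lt_of_le hδ hδp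
    have hq : 0 < q := by rw [hqdef]; linarith [hue.2]
    have hp' : (hermTwo c + hermTwo e).det = p := by rw [← hermTwo_add, det_hermTwo]
    have hq' : (hermTwo c - hermTwo e).det = q := by rw [← hermTwo_sub, det_hermTwo]
    have hbt : 0 < c.2.2 - e.2.2 := sub_snd_pos_of_mem hcm
    have hWn : ‖((hermTwo c - hermTwo e) 1 1)⁻¹‖ = (c.2.2 - e.2.2)⁻¹ := by
      rw [hermTwo_sub_apply_one_one, hermTwo_apply_one_one, ← Complex.ofReal_sub, norm_inv, Complex.norm_of_nonneg hbt.le]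
    have h11 : (hermTwo c + hermTwo e) 1 1 = ((c.2.2 - e.2.2 + 2 * e.2.2 : ℝ) : ℂ) := by
      rw [hermTwo_add_apply_one_one, hermTwo_apply_one_one]; push_cast; ring
    -- the exponents on the ball
    set a : ℝ := (α₀ + u * s).re with hadef
    set b : ℝ := (β₀ + 1 + v * s).re with hbdef
    have hare : a = a₀ + (u * (s - s₀)).re := by rw [hadef, ha₀]; simp only [add_re, mul_re, sub_re, sub_im]; ring
    have hbre : b = b₀ + (v * (s - s₀)).re := by rw [hbdef, hb₀]; simp only [add_re, mul_re, sub_re, sub_im]; ring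
    have hua : |(u * (s - s₀)).re| ≤ ‖u‖ * ε :=
      (Complex.abs_re_le_norm _).trans (by rw [norm_mul]; exact mul_le_mul_of_nonneg_left hsd.le (norm_nonneg _))
    have hvb : |(v * (s - s₀)).re| ≤ ‖v‖ * ε :=
      (Complex.abs_re_le_norm _).trans (by rw [norm_mul]; exact mul_le_mul_of_nonneg_left hsd.le (norm_nonneg _))
    have ha₁a : a₁ ≤ a := by rw [hare, ha₁]; linarith [(abs_le.mp hua).1]
    have haa₂ : a ≤ a₂ := by rw [hare, ha₂]; linarith [(abs_le.mp hua).2]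
    have hb₁b : b₁ ≤ b := by rw [hbre, hb₁]; linarith [(abs_le.mp hvb).1]
    have hbb₂ : b ≤ b₂ := by rw [hbre, hb₂]; linarith [(abs_le.mp hvb).2]
    -- `‖α − 2‖ ≤ M` on the ball and the weight bound `‖Q_α‖ ≤ A b̃⁻¹ + B`
    have hαM : ‖α₀ + u * s - 2‖ ≤ M := by
      rw [show α₀ + u * s - 2 = (α₀ + u * s₀ - 2) + u * (s - s₀) by ring]
      refine (norm_add_le _ _).trans ?_
      rw [hM, norm_mul]
      gcongr
    have hQ : ‖etaShiftWeight G (hermTwo e) (α₀ + u * s) c‖ ≤ A * (c.2.2 - e.2.2)⁻¹ + B := by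
      refine (norm_etaShiftWeight_le G hh hcm (α₀ + u * s)).trans ?_
      rw [← hδdef, hA, hB]
      have h1 : ‖G 0 0‖ + 2 * e.2.2 * ‖α₀ + u * s - 2‖ / δ ≤ ‖G 0 0‖ + 2 * e.2.2 * M / δ := by gcongr
      have h2 : ‖α₀ + u * s - 2‖ / δ ≤ M / δ := by gcongr
      have h3 : 0 ≤ (c.2.2 - e.2.2)⁻¹ := inv_nonneg.mpr hbt.le
      exact add_le_add (mul_le_mul_of_nonneg_right h1 h3) h2
    -- the derivative of the weight: `‖u ρ / b̃‖ ≤ ‖u‖ (1/δ + (2e₃/δ) b̃⁻¹)`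
    have hρ : ‖-(u * ((hermTwo c + hermTwo e) 1 1 / (hermTwo c + hermTwo e).det)) / (hermTwo c - hermTwo e) 1 1‖ ≤
        ‖u‖ * (1 / δ + 2 * e.2.2 / δ * (c.2.2 - e.2.2)⁻¹) := by
      have hX : ‖(hermTwo c + hermTwo e) 1 1‖ = c.2.2 - e.2.2 + 2 * e.2.2 := by
        rw [h11, Complex.norm_of_nonneg (by linarith)]
      have hPn : ‖(hermTwo c + hermTwo e).det‖ = p := by
        rw [hp', Complex.norm_of_nonneg hp.le]
      have hBn : ‖(hermTwo c - hermTwo e) 1 1‖ = c.2.2 - e.2.2 := by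
        rw [hermTwo_sub_apply_one_one, hermTwo_apply_one_one, ← Complex.ofReal_sub, Complex.norm_of_nonneg hbt.le]
      rw [norm_div, norm_neg, norm_mul, norm_div, hX, hPn, hBn]
      have h1 : (c.2.2 - e.2.2 + 2 * e.2.2) / p ≤ (c.2.2 - e.2.2 + 2 * e.2.2) / δ :=
        div_le_div_of_nonneg_left (by linarith) hδ hδp
      have hkey : (c.2.2 - e.2.2 + 2 * e.2.2) / p / (c.2.2 - e.2.2) ≤ 1 / δ + 2 * e.2.2 / δ * (c.2.2 - e.2.2)⁻¹ := by
        calc (c.2.2 - e.2.2 + 2 * e.2.2) / p / (c.2.2 - e.2.2) ≤ (c.2.2 - e.2.2 + 2 * e.2.2) / δ / (c.2.2 - e.2.2) :=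
              div_le_div_of_nonneg_right h1 hbt.le
          _ = 1 / δ + 2 * e.2.2 / δ * (c.2.2 - e.2.2)⁻¹ := by field_simp
      calc ‖u‖ * ((c.2.2 - e.2.2 + 2 * e.2.2) / p) / (c.2.2 - e.2.2) = ‖u‖ * ((c.2.2 - e.2.2 + 2 * e.2.2) / p / (c.2.2 - e.2.2)) := by
            ring
        _ ≤ ‖u‖ * (1 / δ + 2 * e.2.2 / δ * (c.2.2 - e.2.2)⁻¹) := mul_le_mul_of_nonneg_left hkey (norm_nonneg _)
    -- the four elementary bounds (as in ★ `hasDerivAt_etaTwo_affine`)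
    have hpa : p ^ (a - 2) ≤ K₁ * p ^ (a₂ - 2) := rpow_le_max_mul_rpow hδ hδp ha₁a haa₂
    have hqb : q ^ (b - 2) ≤ q ^ (b₁ - 2) + q ^ (b₂ - 2) := by
      have h := Literature.Dynamics.TransferOperators.rpow_neg_le_add (a := 2 - b) (a₁ := 2 - b₂) (a₂ := 2 - b₁) hq
        (by linarith) (by linarith)
      rw [neg_sub, neg_sub, neg_sub] at h
      linarith
    have hLp : |Real.log p| ≤ K₂ * p := abs_log_le_mul_of_le hδ hδp
    have hLq : |Real.log q| ≤ (q ^ θ + q ^ (-θ)) / θ := abs_log_le_rpow_add_rpow_div hq hθpos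
    -- the coefficient of the log term
    have hcoef : ‖u * Complex.log ((hermTwo c + hermTwo e).det) + v * Complex.log ((hermTwo c - hermTwo e).det)‖ ≤
        ‖u‖ * |Real.log p| + ‖v‖ * |Real.log q| := by
      rw [hp', hq', ← Complex.ofReal_log hp.le, ← Complex.ofReal_log hq.le]
      refine (norm_add_le _ _).trans (le_of_eq ?_)
      rw [norm_mul, norm_mul, Complex.norm_real, Complex.norm_real, Real.norm_eq_abs, Real.norm_eq_abs]
    -- all `η`-norms in terms of `p`, `q`
    have hEn : ‖etaTwoIntegrand G (hermTwo e) (α₀ + u * s) (β₀ + 1 + v * s) c‖ =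
        ‖cexp (-(hermTwo c * G).trace)‖ * (p ^ (a - 2) * q ^ (b - 2)) := by
      rw [norm_etaTwoIntegrand_eq hp hq hp' hq', ← hadef, ← hbdef]
    have hSn : ‖etaShiftIntegrand G (hermTwo e) (α₀ + u * s) (β₀ + v * s) c‖ =
        ‖etaShiftWeight G (hermTwo e) (α₀ + u * s) c‖ * (‖cexp (-(hermTwo c * G).trace)‖ * (p ^ (a - 2) * q ^ (b - 2))) := by
      rw [etaShiftIntegrand_apply, norm_mul, add_right_comm β₀ (v * s) 1, hEn]
    refine (norm_add_le _ _).trans ?_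
    rw [norm_mul, norm_mul, hSn, hEn, hWn]
    simp only [norm_etaTwoIntegrand_eq hp hq hp' hq', Complex.ofReal_re]
    set P₀ : ℝ := ‖cexp (-(hermTwo c * G).trace)‖ with hP₀def
    set P : ℝ := ‖cexp (-(hermTwo c * g₁).trace)‖ with hPdef
    have hP₀P : P₀ ≤ P := hdom c hc
    have hP₀0 : 0 ≤ P₀ := norm_nonneg _
    set W : ℝ := ‖etaShiftWeight G (hermTwo e) (α₀ + u * s) c‖ with hWdef
    set R : ℝ := ‖-(u * ((hermTwo c + hermTwo e) 1 1 / (hermTwo c + hermTwo e).det)) / (hermTwo c - hermTwo e) 1 1‖ with hRdef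
    set L : ℝ := ‖u * Complex.log ((hermTwo c + hermTwo e).det) + v * Complex.log ((hermTwo c - hermTwo e).det)‖ with hLdef
    have e1 : p ^ (a₂ + 1 - 2) = p ^ (a₂ - 2) * p := by
      rw [show a₂ + 1 - 2 = (a₂ - 2) + 1 by ring, Real.rpow_add_one hp.ne']
    have e3 : q ^ (b₁ + θ - 2) = q ^ (b₁ - 2) * q ^ θ := by
      rw [show b₁ + θ - 2 = (b₁ - 2) + θ by ring, Real.rpow_add hq]
    have e4 : q ^ (b₁ - θ - 2) = q ^ (b₁ - 2) * q ^ (-θ) := by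
      rw [show b₁ - θ - 2 = (b₁ - 2) + (-θ) by ring, Real.rpow_add hq]
    have e5 : q ^ (b₂ + θ - 2) = q ^ (b₂ - 2) * q ^ θ := by
      rw [show b₂ + θ - 2 = (b₂ - 2) + θ by ring, Real.rpow_add hq]
    have e6 : q ^ (b₂ - θ - 2) = q ^ (b₂ - 2) * q ^ (-θ) := by
      rw [show b₂ - θ - 2 = (b₂ - 2) + (-θ) by ring, Real.rpow_add hq]
    rw [e1, e3, e4, e5, e6]
    have hP0 : 0 ≤ P := norm_nonneg _
    have hW0 : 0 ≤ W := norm_nonneg _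
    have hL0 : 0 ≤ L := norm_nonneg _
    have hbt' : 0 ≤ (c.2.2 - e.2.2)⁻¹ := inv_nonneg.mpr hbt.le
    have hLle : L ≤ ‖u‖ * (K₂ * p) + ‖v‖ * ((q ^ θ + q ^ (-θ)) / θ) := by
      refine hcoef.trans ?_
      gcongr
    have hq0 : ∀ r : ℝ, 0 ≤ q ^ r := fun r => Real.rpow_nonneg hq.le r
    have hp0 : ∀ r : ℝ, 0 ≤ p ^ r := fun r => Real.rpow_nonneg hp.le r
    have hX : p ^ (a - 2) * q ^ (b - 2) ≤ K₁ * p ^ (a₂ - 2) * (q ^ (b₁ - 2) + q ^ (b₂ - 2)) :=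
      (mul_le_mul hpa hqb (hq0 _) (mul_nonneg hK₁0 (hp0 _))).trans (le_of_eq (by ring))
    have hX0 : 0 ≤ K₁ * p ^ (a₂ - 2) * (q ^ (b₁ - 2) + q ^ (b₂ - 2)) :=
      mul_nonneg (mul_nonneg hK₁0 (hp0 _)) (add_nonneg (hq0 _) (hq0 _))
    have hpq0 : 0 ≤ P₀ * (p ^ (a - 2) * q ^ (b - 2)) := mul_nonneg hP₀0 (mul_nonneg (hp0 _) (hq0 _))
    have hPX : P₀ * (p ^ (a - 2) * q ^ (b - 2)) ≤ P * (K₁ * p ^ (a₂ - 2) * (q ^ (b₁ - 2) + q ^ (b₂ - 2))) :=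
      mul_le_mul hP₀P hX (mul_nonneg (hp0 _) (hq0 _)) hP0
    have hPX0 : 0 ≤ P * (K₁ * p ^ (a₂ - 2) * (q ^ (b₁ - 2) + q ^ (b₂ - 2))) := mul_nonneg hP0 hX0
    have hAB0 : 0 ≤ A * (c.2.2 - e.2.2)⁻¹ + B := add_nonneg (mul_nonneg hA0 hbt') hB0
    have hδinv : 0 ≤ 1 / δ := by positivity
    have he3δ : 0 ≤ 2 * e.2.2 / δ := by positivity
    have hR'0 : 0 ≤ ‖u‖ * (1 / δ + 2 * e.2.2 / δ * (c.2.2 - e.2.2)⁻¹) :=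
      mul_nonneg (norm_nonneg _) (add_nonneg hδinv (mul_nonneg he3δ hbt'))
    have hT1 : W * (P₀ * (p ^ (a - 2) * q ^ (b - 2))) * L ≤
        (A * (c.2.2 - e.2.2)⁻¹ + B) * (P * (K₁ * p ^ (a₂ - 2) * (q ^ (b₁ - 2) + q ^ (b₂ - 2)))) *
          (‖u‖ * (K₂ * p) + ‖v‖ * ((q ^ θ + q ^ (-θ)) / θ)) :=
      mul_le_mul (mul_le_mul hQ hPX hpq0 hAB0) hLle hL0 (mul_nonneg hAB0 hPX0)
    have hT2 : R * (P₀ * (p ^ (a - 2) * q ^ (b - 2))) ≤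
        ‖u‖ * (1 / δ + 2 * e.2.2 / δ * (c.2.2 - e.2.2)⁻¹) * (P * (K₁ * p ^ (a₂ - 2) * (q ^ (b₁ - 2) + q ^ (b₂ - 2)))) :=
      mul_le_mul hρ hPX hpq0 hR'0
    calc W * (P₀ * (p ^ (a - 2) * q ^ (b - 2))) * L + R * (P₀ * (p ^ (a - 2) * q ^ (b - 2)))
        ≤ (A * (c.2.2 - e.2.2)⁻¹ + B) * (P * (K₁ * p ^ (a₂ - 2) * (q ^ (b₁ - 2) + q ^ (b₂ - 2)))) *
            (‖u‖ * (K₂ * p) + ‖v‖ * ((q ^ θ + q ^ (-θ)) / θ)) +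
          ‖u‖ * (1 / δ + 2 * e.2.2 / δ * (c.2.2 - e.2.2)⁻¹) * (P * (K₁ * p ^ (a₂ - 2) * (q ^ (b₁ - 2) + q ^ (b₂ - 2)))) :=
          add_le_add hT1 hT2
      _ = ‖u‖ * K₁ / δ * (P * (p ^ (a₂ - 2) * q ^ (b₁ - 2)) + P * (p ^ (a₂ - 2) * q ^ (b₂ - 2))) +
          ‖u‖ * K₁ * (2 * e.2.2 / δ) *
            ((c.2.2 - e.2.2)⁻¹ * (P * (p ^ (a₂ - 2) * q ^ (b₁ - 2))) + (c.2.2 - e.2.2)⁻¹ * (P * (p ^ (a₂ - 2) * q ^ (b₂ - 2)))) +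
          B * (‖u‖ * (K₁ * K₂) * (P * (p ^ (a₂ - 2) * p * q ^ (b₁ - 2)) + P * (p ^ (a₂ - 2) * p * q ^ (b₂ - 2))) +
            ‖v‖ / θ * K₁ *
              (P * (p ^ (a₂ - 2) * (q ^ (b₁ - 2) * q ^ θ)) + P * (p ^ (a₂ - 2) * (q ^ (b₁ - 2) * q ^ (-θ))) +
                P * (p ^ (a₂ - 2) * (q ^ (b₂ - 2) * q ^ θ)) + P * (p ^ (a₂ - 2) * (q ^ (b₂ - 2) * q ^ (-θ))))) +
          A * (‖u‖ * (K₁ * K₂) *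
              ((c.2.2 - e.2.2)⁻¹ * (P * (p ^ (a₂ - 2) * p * q ^ (b₁ - 2))) + (c.2.2 - e.2.2)⁻¹ * (P * (p ^ (a₂ - 2) * p * q ^ (b₂ - 2)))) +
            ‖v‖ / θ * K₁ *
              ((c.2.2 - e.2.2)⁻¹ * (P * (p ^ (a₂ - 2) * (q ^ (b₁ - 2) * q ^ θ))) + (c.2.2 - e.2.2)⁻¹ * (P * (p ^ (a₂ - 2) * (q ^ (b₁ - 2) * q ^ (-θ)))) +
                (c.2.2 - e.2.2)⁻¹ * (P * (p ^ (a₂ - 2) * (q ^ (b₂ - 2) * q ^ θ))) + (c.2.2 - e.2.2)⁻¹ * (P * (p ^ (a₂ - 2) * (q ^ (b₂ - 2) * q ^ (-θ)))))) := by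
          field_simp
          ring
  · -- integrability of the bound
    exact (((((hI1.add hI2).const_mul _).add ((hJ1.add hJ2).const_mul _)).add
      ((((hI3.add hI4).const_mul _).add ((((hI5.add hI6).add hI7).add hI8).const_mul _)).const_mul _)).add
      ((((hJ3.add hJ4).const_mul _).add ((((hJ5.add hJ6).add hJ7).add hJ8).const_mul _)).const_mul _))
  · -- the pointwise derivative, for `x` in the domain
    refine (ae_restrict_iff' (measurableSet_etaTwoSet hh.1)).mpr (Filter.Eventually.of_forall fun c hc s _ => ?_)
    have hpq := det_pos_of_mem_etaTwoSet hc
    exact hasDerivAt_etaShiftIntegrand_affine G (hermTwo e) hpq.1.ne' hpq.2.ne' α₀ β₀ u v s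


/-- **THE β-SHIFTED `η` OF A DOMINATED `G` IS HOLOMORPHIC ALONG COMPLEX LINES IN `ℂ × {re β > 0}`**. -/
theorem differentiableOn_etaShift_affine_of_dominated {G g₁ h : Matrix (Fin 2) (Fin 2) ℂ} (hg₁ : g₁.PosDef) (hh : h.PosDef)
    (hdom : ∀ c ∈ etaTwoSet h, ‖cexp (-(hermTwo c * G).trace)‖ ≤ ‖cexp (-(hermTwo c * g₁).trace)‖) (α₀ β₀ u v : ℂ) :
    DifferentiableOn ℂ (fun s : ℂ => etaShift G h (α₀ + u * s) (β₀ + v * s)) {s : ℂ | 0 < (β₀ + v * s).re} :=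
  fun _ hs => (hasDerivAt_etaShift_affine_of_dominated hg₁ hh hdom α₀ β₀ u v hs).differentiableAt.differentiableWithinAt

/-- The same on any `U ⊆ {s | 0 < re(β₀ + v s)}`. -/
theorem differentiableOn_etaShift_affine_of_dominated_of_subset {G g₁ h : Matrix (Fin 2) (Fin 2) ℂ} (hg₁ : g₁.PosDef) (hh : h.PosDef)
    (hdom : ∀ c ∈ etaTwoSet h, ‖cexp (-(hermTwo c * G).trace)‖ ≤ ‖cexp (-(hermTwo c * g₁).trace)‖) (α₀ β₀ u v : ℂ)
    {U : Set ℂ} (hU0 : ∀ s ∈ U, 0 < (β₀ + v * s).re) :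
    DifferentiableOn ℂ (fun s : ℂ => etaShift G h (α₀ + u * s) (β₀ + v * s)) U :=
  (differentiableOn_etaShift_affine_of_dominated hg₁ hh hdom α₀ β₀ u v).mono fun s hs => hU0 s hs

end Summit.HodgeConjecture.HodgeConjecture.Cruxes.HLiu418.K2LiuHermTwoEtaShiftDominated

end
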